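import Literature.AlgebraicGeometry.Motives.HodgeStructureLefschetzGroupTraceTransfer
import Literature.AlgebraicGeometry.Motives.HodgeStructureLefschetzGroupEigenspaceSplitting
import HarnessLib

/-!
# "`(V_σ, φ_σ) = (V(A), φ) ⊗_{F,σ} k^al`": the `σ`-coordinate of Milne's transferred pairing `φ_{Q,K}` is the polarization
# read on the `σ`-block — `ev_σ ∘ φ_{Q,K} = Q_K(π_σ ·, ·)`, `ι_K(e_σ) = π_σ`, `φ_{Q,K} = Σ_σ Q_K(π_σ ·, ·) e_σ`
# (Milne 1999 §2 pp. 646–649, on the abstract polarized `ℚ`-Hodge structure, on the points in a splitting field)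

[topic AlgebraicGeometry/Motives]

Layer `Literature/AlgebraicGeometry/Motives`, lane `lit-hodgefound` (Track 2 foundations library; seat `lit-hodgefound-p34`,
generation 20, self-proposed row g20-#3 of `run/shared/lean/pub/lit-hodgefound/SKELETON.md`): the DICTIONARY between the
seat's g20-#1 `Motives/HodgeStructureLefschetzGroupTraceTransfer` (Milne's unique pairing `φ` with `Tr_{L/k} ∘ φ = e_D`, on
`K`-points `φ_{Q,K} = Q.hermitianTransferBaseChange K A`, the action `ι_K = baseChangeAction K A.ι` of `K ⊗_ℚ F`) and g20-#2
`Motives/HodgeStructureLefschetzGroupEigenspaceSplitting` (the blocks `V_{K,σ} = A.eigenspaceBaseChange K σ` with projectors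
`π_σ = A.eigenprojBaseChange K τ σ`, "`S(A)_{k^al} ≅ ∏_σ Sp(φ_σ)`" read on `Q_K|_{V_σ}`). THEOREMS plus two generic
definitions WITH BODIES (`baseChangeEval K χ : K ⊗_k L →ₐ[K] K`, the `χ`-coordinate `c ⊗ a ↦ c χ(a)`, and
`splitIdempotent K τ hL s ∈ K ⊗_k L`, the primitive idempotent `e_σ = Σₘ σ(bᵐ) ⊗ bₘ`); no named fact (net debt `0`).

CARRIER. As in g20-#1/#2: `H : HodgeStructure V n`, `Q : Polarization H`, `A : EndAction H F` (`F` a number field acting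
by Hodge endomorphisms), a field `K ⊇ ℚ` with an injective family `τ : S → (F →ₐ[ℚ] K)`, `card S = [F:ℚ]` (Milne's `k^al`).
§1 is generic (`k`, a finite-dimensional commutative `k`-algebra `L` with non-degenerate trace form, a field `K ⊇ k`
splitting it through `τ`).

## The source, verbatim

J. S. Milne, *Lefschetz classes on abelian varieties*, Duke Math. J. **96** (1999) 639–675 [Milne1999LefschetzClasses]
(held `paper:doi-10-1215-s0012-7094-99-09620-5`; Duke page = folio + 638). §2 p. 646 (p0008) L43–L48: "Let
`F ⊗_ℚ k = F₁ × ⋯ × F_t` be the decomposition of `F ⊗_ℚ k` into a product of fields, and let `1 = e₁ + ⋯ + e_t` be the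
corresponding decomposition of `1` into a sum of orthogonal idempotents. Then `V(A) = V₁ ⊕ ⋯ ⊕ V_t`,
`Vᵢ = eᵢV = V ⊗_{F ⊗_ℚ k} Fᵢ`." p. 647 (p0009) L1–L4: "let `φ : V × V → F ⊗_ℚ k` be the skew-symmetric
`F ⊗_ℚ k`-bilinear form such that `Tr_{F ⊗_ℚ k/k} φ = e_D`. Because `φ ∘ (α × 1) = φ ∘ (1 × α)` for `α ∈ F`, `φ` decomposes
into `φ = φ₁ ⊕ ⋯ ⊕ φ_t`, where `φᵢ : Vᵢ × Vᵢ → Fᵢ` is skew-symmetric and `Fᵢ`-bilinear." p. 649 (p0011) L1–L29: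
"**if `F ⊗_ℚ k^al = ∏_{σ:F→k^al} k_σ`, `k_σ = k^al`, is the decomposition of `F ⊗_ℚ k^al` into a product of fields, then
`(V(A), φ) ⊗_k k^al = ⊕_{σ:F→k^al} (V_σ, φ_σ)`, `(V_σ, φ_σ) = (V(A), φ) ⊗_{F,σ} k^al` and `S(A)_{k^al} ≅ ∏_{σ:F→k^al} Sp(φ_σ)`.**"
Remark 2.2 p. 647 L29–L45: "`φ((x₁, x₂), (y₁, y₂)) = (φ₁(x₁, y₂), −φ₁(x₂, y₁))`".

## What is PROVED

* §1 (generic). DEF `baseChangeEval K χ` (`ev_χ(c ⊗ a) = c χ(a)`; `baseChangeEval_congr_refl`: `ev_χ ∘ (1 ⊗ σ′) = ev_{χ∘σ′}`);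
  **`trace_eq_sum_baseChangeEval`: `Tr_{(K ⊗ L)/K} = Σ_σ ev_σ`** for `K` splitting `L` (from the tree's
  `Deligne1982.algebraMap_trace_eq_sum_embeddings` and g20-#1's `trace_baseChange_tmul'`); DEF `splitIdempotent K τ hL s = e_σ`
  with **`baseChangeEval_splitIdempotent`: `ev_τ(e_σ) = δ_{στ}`** (the tree's `Deligne1982.sum_embedding_dualBasis_mul_embedding`),
  `baseChangeEval_eq_trace_splitIdempotent_mul` (`ev_σ(z) = Tr(e_σ z)`), **`sum_baseChangeEval_smul_splitIdempotent`:
  `z = Σ_σ ev_σ(z) e_σ`** ("`1 = e₁ + ⋯ + e_t`"; via the non-degenerate trace form over `K`, g20-#1's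
  `nondegenerate_traceForm_baseChange`), `eq_of_forall_baseChangeEval_eq` (coordinates separate).
* §2 (the Hodge structure). **`EndAction.baseChangeAction_splitIdempotent`: `ι_K(e_σ) = π_σ`** ("`Vᵢ = eᵢV`");
  **`Polarization.baseChangeEval_hermitianTransferBaseChange`: `ev_σ(φ_{Q,K}(x, y)) = Q_K(π_σ x, y)`**;
  **`Polarization.hermitianTransferBaseChange_eq_sum_smul_splitIdempotent`: `φ_{Q,K}(x, y) = Σ_σ Q_K(π_σ x, y) e_σ`**
  ("`φ = φ₁ ⊕ ⋯ ⊕ φ_t`"); **`Polarization.hermitianTransferBaseChange_apply_of_mem_eigenspaceBaseChange`: for `x ∈ V_{K,σ}`,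
  `φ_{Q,K}(x, y) = Q_K(x, y) e_σ`** — "`(V_σ, φ_σ) = (V(A), φ) ⊗_{F,σ} k^al`": `φ_σ` IS `e_D = Q_K` on the `σ`-block, in the
  `σ`-coordinate; type I (`σ′ = 1`, `Q(ι(a)v, w) = Q(v, ι(a)w)`): `…_of_forall_form_ι` (`ev_σ φ_{Q,K}(x, y) = Q_K(π_σ x, π_σ y)`);
  general Rosati involution `σ′`: `…_of_pair` (`ev_{τₛ} φ_{Q,K}(x, y) = Q_K(π_s x, π_t y)` on the paired blocks
  `τₛ = τₜ ∘ σ′`, Remark 2.2); and the dictionary between the two readings of `S(H)(K)`: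
  **`Polarization.forall_hermitianTransferBaseChange_eq_iff_forall_blocks`** — for ANY self-map `γ` of `K ⊗ V`,
  "`φ_{Q,K}(γx, γy) = φ_{Q,K}(x, y) ∀`" ⟺ "`Q_K(π_σ γx, π_σ γy) = Q_K(π_σ x, π_σ y) ∀ σ`" (type I), so g20-#1's
  `S(H)(K) = Aut_{K ⊗ F}(K ⊗ V, φ_{Q,K})` and g20-#2's `S(H)(K) = ∏_σ Sp(V_{K,σ}, Q_K|)` are the same statement.

NOT here: the intermediate non-split decomposition `F ⊗ k = ∏ Fᵢ` with `Fᵢ ≠ k`; the algebra isomorphism `K ⊗_ℚ F ≃ₐ K^S`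
as a bundled `AlgEquiv` (the tree has it for `K = ℂ`: `RealMult.embCoordsAlgEquiv`, `Motives/HodgeStructureCMActionScalarExtension`,
BY NAME; here only its coordinates `ev_σ` and idempotents `e_σ`); types II–IV.

## References

* [Milne1999LefschetzClasses] J. S. Milne, *Lefschetz classes on abelian varieties*, Duke Math. J. 96 (1999) 639–675, §2
  pp. 646–649.
* [Deligne1982HodgeCycles] P. Deligne, *Hodge cycles on abelian varieties*, LNM 900 (1982), §4 proof of Prop. 4.4
  (`E ⊗_ℚ ℂ ⥲ ∏_{σ∈S} ℂ`, `Tr = Σ σ`).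
-/

noncomputable section

open scoped TensorProduct

namespace Literature.AlgebraicGeometry.Motives

/-! ## §1 The coordinates `ev_σ : K ⊗_k L → K` of a split algebra, `Tr = Σ_σ ev_σ`, and the primitive idempotents `e_σ` -/

section SplitCoordinates

variable {k : Type*} [Field k] {L : Type*} [CommRing L] [Algebra k L] (K : Type*) [Field K] [Algebra k K]

/-- **The `σ`-coordinate `ev_σ : K ⊗_k L → K`, `c ⊗ a ↦ c σ(a)`** of the `K`-algebra `K ⊗_k L` at a `k`-algebra map
`σ : L → K` — the projection `F ⊗_ℚ k^al = ∏_σ k_σ → k_σ` of Milne's decomposition.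
[cite: Milne1999LefschetzClasses, §2 p. 649 L1–L4 ("F ⊗_ℚ k^al = ∏_{σ:F→k^al} k_σ, k_σ = k^al")] -/
def baseChangeEval (χ : L →ₐ[k] K) : K ⊗[k] L →ₐ[K] K :=
  Algebra.TensorProduct.lift (AlgHom.id K K) χ fun _ _ => Commute.all _ _

/-- `ev_σ(c ⊗ a) = c σ(a)`. [cite: Milne1999LefschetzClasses, §2 p. 649 L1–L4] -/
@[simp] theorem baseChangeEval_tmul (χ : L →ₐ[k] K) (c : K) (a : L) : baseChangeEval K χ (c ⊗ₜ a) = c * χ a := by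
  rw [baseChangeEval, Algebra.TensorProduct.lift_tmul, AlgHom.id_apply]

/-- `ev_σ ∘ σ′_K`-compatibility with `1 ⊗ σ′`: `ev_χ((1 ⊗ σ′) z) = ev_{χ ∘ σ′}(z)`. [cite: Milne1999LefschetzClasses, §2 p. 649 L1–L4] -/
theorem baseChangeEval_congr_refl (χ : L →ₐ[k] K) (σ' : L ≃ₐ[k] L) (z : K ⊗[k] L) :
    baseChangeEval K χ (Algebra.TensorProduct.congr (AlgEquiv.refl : K ≃ₐ[K] K) σ' z) =
      baseChangeEval K (χ.comp (σ' : L →ₐ[k] L)) z := by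
  induction z using TensorProduct.induction_on with
  | zero => simp
  | tmul c a => rw [congr_refl_tmul, baseChangeEval_tmul, baseChangeEval_tmul, AlgHom.comp_apply, AlgEquiv.coe_toAlgHom]
  | add x y hx hy => rw [map_add, map_add, hx, hy, map_add]

variable [FiniteDimensional k L] {S : Type*} [Fintype S] (τ : S → (L →ₐ[k] K))

/-- **`Tr_{(K ⊗ L)/K} = Σ_σ ev_σ` when `K` splits `L`** (the trace of `∏_σ K` is the sum of the coordinates; Deligne's
`Tr_{k′/k}(x) = Σₛ σₛ(x)`, the tree's `Deligne1982.algebraMap_trace_eq_sum_embeddings`, base-changed).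
[cite: Milne1999LefschetzClasses, §2 p. 649 L1–L8] [cite: Deligne1982HodgeCycles, §4 proof of Prop. 4.4 (re-ed. p. 30)] -/
theorem trace_eq_sum_baseChangeEval (hτ : Function.Injective τ) (hcard : Fintype.card S = Module.finrank k L)
    (z : K ⊗[k] L) : Algebra.trace K (K ⊗[k] L) z = ∑ s, baseChangeEval K (τ s) z := by
  induction z using TensorProduct.induction_on with
  | zero => simp
  | tmul c a =>
    rw [trace_baseChange_tmul', Deligne1982.algebraMap_trace_eq_sum_embeddings k L K hτ hcard a, Finset.mul_sum]
    simp_rw [baseChangeEval_tmul]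
  | add x y hx hy => rw [map_add, hx, hy, ← Finset.sum_add_distrib]; simp_rw [map_add]

variable (hL : (Algebra.traceForm k L).Nondegenerate)

/-- **The primitive idempotent `e_σ = Σₘ σ(bᵐ) ⊗ bₘ` of `K ⊗_k L ⥲ K^S`** (`b` the basis `Module.finBasis k L`, `(bᵐ)` its
trace-dual basis) — Milne's `eᵢ` with `Vᵢ = eᵢ V`, read over a splitting field. [cite: Milne1999LefschetzClasses, §2 p. 646 L43–L48 ("1 = e₁ + ⋯ + e_t … orthogonal idempotents")] -/
def splitIdempotent (s : S) : K ⊗[k] L :=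
  ∑ m, τ s ((Algebra.traceForm k L).dualBasis hL (Module.finBasis k L) m) ⊗ₜ Module.finBasis k L m

/-- **`ev_τₜ(e_τₛ) = δₛₜ`** (the orthogonality `Σₘ σₛ(bᵐ) σₜ(bₘ) = δₛₜ`, the tree's
`Deligne1982.sum_embedding_dualBasis_mul_embedding`). [cite: Milne1999LefschetzClasses, §2 p. 646 L43–L48] -/
theorem baseChangeEval_splitIdempotent [DecidableEq S] (hτ : Function.Injective τ)
    (hcard : Fintype.card S = Module.finrank k L) (s t : S) :
    baseChangeEval K (τ t) (splitIdempotent K τ hL s) = if s = t then 1 else 0 := by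
  rw [splitIdempotent, map_sum]
  simp_rw [baseChangeEval_tmul]
  exact Deligne1982.sum_embedding_dualBasis_mul_embedding k L K hτ hcard hL _ s t

/-- `ev_σ(z) = Tr(e_σ z)`: the `σ`-coordinate is the trace against the idempotent. [cite: Milne1999LefschetzClasses, §2 p. 646 L43–L48 and p. 649 L1–L8] -/
theorem baseChangeEval_eq_trace_splitIdempotent_mul (hτ : Function.Injective τ)
    (hcard : Fintype.card S = Module.finrank k L) (s : S) (z : K ⊗[k] L) :
    baseChangeEval K (τ s) z = Algebra.trace K (K ⊗[k] L) (splitIdempotent K τ hL s * z) := by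
  classical
  rw [trace_eq_sum_baseChangeEval K τ hτ hcard]
  simp_rw [map_mul, baseChangeEval_splitIdempotent K τ hL hτ hcard, ite_mul, one_mul, zero_mul]
  rw [Finset.sum_ite_eq Finset.univ s, if_pos (Finset.mem_univ s)]

/-- **`z = Σ_σ ev_σ(z) e_σ`**: the `e_σ` are a `K`-basis of coordinates of `K ⊗_k L ⥲ K^S` ("`1 = e₁ + ⋯ + e_t`"; both sides
have the same traces against every `w`). [cite: Milne1999LefschetzClasses, §2 p. 646 L43–L48] -/
theorem sum_baseChangeEval_smul_splitIdempotent (hτ : Function.Injective τ) (hcard : Fintype.card S = Module.finrank k L)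
    (z : K ⊗[k] L) : ∑ s, baseChangeEval K (τ s) z • splitIdempotent K τ hL s = z := by
  classical
  refine (eq_of_forall_trace_mul_eq_of_nondegenerate (nondegenerate_traceForm_baseChange K hL) fun w => ?_).symm
  rw [Finset.sum_mul, map_sum, trace_eq_sum_baseChangeEval K τ hτ hcard (z * w)]
  refine Finset.sum_congr rfl fun s _ => ?_
  rw [smul_mul_assoc, LinearMap.map_smul, ← baseChangeEval_eq_trace_splitIdempotent_mul K τ hL hτ hcard, smul_eq_mul, map_mul]

/-- Two elements of `K ⊗_k L` with the same coordinates `ev_σ` are equal (`K` splitting `L`).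
[cite: Milne1999LefschetzClasses, §2 p. 649 L1–L4] -/
theorem eq_of_forall_baseChangeEval_eq (hL : (Algebra.traceForm k L).Nondegenerate) (hτ : Function.Injective τ)
    (hcard : Fintype.card S = Module.finrank k L) {z z' : K ⊗[k] L} (h : ∀ s, baseChangeEval K (τ s) z = baseChangeEval K (τ s) z') : z = z' := by
  rw [← sum_baseChangeEval_smul_splitIdempotent K τ hL hτ hcard z, ← sum_baseChangeEval_smul_splitIdempotent K τ hL hτ hcard z']
  simp_rw [h]

end SplitCoordinates

/-! ## §2 On the Hodge structure: `ι_K(e_σ) = π_σ` and `ev_σ ∘ φ_{Q,K} = Q_K(π_σ ·, ·)` — "`(V_σ, φ_σ) = (V(A), φ) ⊗_{F,σ} k^al`" -/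

namespace HodgeStructure

universe u uK

variable {V : Type u} [AddCommGroup V] [Module ℚ V] {n : ℤ} {H : HodgeStructure V n}
variable {F : Type*} [Field F] [NumberField F]
variable (K : Type uK) [Field K] [Algebra ℚ K] (A : EndAction H F) (Q : Polarization H)
variable {S : Type*} [Fintype S] (τ : S → (F →ₐ[ℚ] K))

omit [Fintype S] in
/-- **`ι_K(e_σ) = π_σ`**: the primitive idempotent of `K ⊗ F` acts on `K ⊗ V` as the projector onto the block `V_{K,σ}`
("`Vᵢ = eᵢ V`"). [cite: Milne1999LefschetzClasses, §2 p. 646 L43–L48 ("Vᵢ = eᵢV = V ⊗_{F⊗k} Fᵢ")] -/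
theorem EndAction.baseChangeAction_splitIdempotent (s : S) :
    baseChangeAction K A.ι (splitIdempotent K τ (traceForm_nondegenerate ℚ F) s) = A.eigenprojBaseChange K τ s := by
  rw [splitIdempotent, map_sum, A.eigenprojBaseChange_eq_sum K τ s]
  exact Finset.sum_congr rfl fun m _ => by rw [baseChangeAction_tmul]

/-- **`ev_σ(φ_{Q,K}(x, y)) = Q_K(π_σ x, y)`** — the `σ`-coordinate of Milne's transferred pairing is the polarization read on
the `σ`-block: "`(V_σ, φ_σ) = (V(A), φ) ⊗_{F,σ} k^al`" with `e_D = Tr ∘ φ = Σ_σ φ_σ` (from `ev_σ = Tr(e_σ ·)`,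
`Tr(φ_{Q,K}(x, y) z) = Q_K(ι_K(z) x, y)` and `ι_K(e_σ) = π_σ`). [cite: Milne1999LefschetzClasses, §2 p. 649 L1–L8 ("(V(A), φ) ⊗_k k^al = ⊕_σ (V_σ, φ_σ), (V_σ, φ_σ) = (V(A), φ) ⊗_{F,σ} k^al")] -/
theorem Polarization.baseChangeEval_hermitianTransferBaseChange (hτ : Function.Injective τ)
    (hcard : Fintype.card S = Module.finrank ℚ F) (s : S) (x y : K ⊗[ℚ] V) :
    baseChangeEval K (τ s) (Q.hermitianTransferBaseChange K A x y) =
      Q.form.baseChange K (A.eigenprojBaseChange K τ s x) y := by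
  rw [baseChangeEval_eq_trace_splitIdempotent_mul K τ (traceForm_nondegenerate ℚ F) hτ hcard, mul_comm,
    Q.trace_hermitianTransferBaseChange_mul K A, A.baseChangeAction_splitIdempotent K τ s]

/-- **`φ_{Q,K}(x, y) = Σ_σ Q_K(π_σ x, y) · e_σ`** — the transferred pairing decomposed along `K ⊗ F ⥲ K^S`
("`φ = φ₁ ⊕ ⋯ ⊕ φ_t`"). [cite: Milne1999LefschetzClasses, §2 p. 647 L1–L4 ("φ decomposes into φ = φ₁ ⊕ ⋯ ⊕ φ_t") and p. 649 L1–L8] -/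
theorem Polarization.hermitianTransferBaseChange_eq_sum_smul_splitIdempotent (hτ : Function.Injective τ)
    (hcard : Fintype.card S = Module.finrank ℚ F) (x y : K ⊗[ℚ] V) :
    Q.hermitianTransferBaseChange K A x y =
      ∑ s, Q.form.baseChange K (A.eigenprojBaseChange K τ s x) y • splitIdempotent K τ (traceForm_nondegenerate ℚ F) s := by
  conv_lhs => rw [← sum_baseChangeEval_smul_splitIdempotent K τ (traceForm_nondegenerate ℚ F) hτ hcard
    (Q.hermitianTransferBaseChange K A x y)]
  simp_rw [Q.baseChangeEval_hermitianTransferBaseChange K A τ hτ hcard]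

/-- **On the block `V_{K,σ}`: `φ_{Q,K}(x, y) = Q_K(x, y) · e_σ` for `x ∈ V_{K,σ}`** — `φ_σ` IS `e_D` restricted to the
`σ`-block, placed in the `σ`-coordinate ("`(V_σ, φ_σ) = (V(A), φ) ⊗_{F,σ} k^al`"). [cite: Milne1999LefschetzClasses, §2 p. 649 L1–L8] -/
theorem Polarization.hermitianTransferBaseChange_apply_of_mem_eigenspaceBaseChange (hτ : Function.Injective τ)
    (hcard : Fintype.card S = Module.finrank ℚ F) {s : S} {x : K ⊗[ℚ] V} (hx : x ∈ A.eigenspaceBaseChange K (τ s))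
    (y : K ⊗[ℚ] V) :
    Q.hermitianTransferBaseChange K A x y = Q.form.baseChange K x y • splitIdempotent K τ (traceForm_nondegenerate ℚ F) s := by
  classical
  rw [Q.hermitianTransferBaseChange_eq_sum_smul_splitIdempotent K A τ hτ hcard]
  refine (Finset.sum_eq_single s (fun t _ hts => ?_) (fun h => absurd (Finset.mem_univ s) h)).trans ?_
  · rw [A.eigenprojBaseChange_apply_eq_zero_of_mem K τ hτ hcard hts hx, map_zero, LinearMap.zero_apply, zero_smul]
  · rw [A.eigenprojBaseChange_apply_eq_self_of_mem K τ hτ hcard hx]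

/-- **Type I (`σ = 1`): `ev_σ(φ_{Q,K}(x, y)) = Q_K(π_σ x, π_σ y)`** — `φ_σ` is `e_D` on `V_σ × V_σ` (the blocks are
`Q_K`-orthogonal). [cite: Milne1999LefschetzClasses, §2 p. 648 L43–L48 and p. 649 L1–L8 ("S(A)_{k^al} ≅ ∏_σ Sp(φ_σ)")] -/
theorem Polarization.baseChangeEval_hermitianTransferBaseChange_of_forall_form_ι (hτ : Function.Injective τ)
    (hcard : Fintype.card S = Module.finrank ℚ F) (hsym : ∀ a v w, Q.form (A.ι a v) w = Q.form v (A.ι a w)) (s : S)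
    (x y : K ⊗[ℚ] V) :
    baseChangeEval K (τ s) (Q.hermitianTransferBaseChange K A x y) =
      Q.form.baseChange K (A.eigenprojBaseChange K τ s x) (A.eigenprojBaseChange K τ s y) := by
  rw [Q.baseChangeEval_hermitianTransferBaseChange K A τ hτ hcard s x y]
  conv_lhs => rw [← A.sum_eigenprojBaseChange_apply K τ hτ hcard y]
  rw [map_sum]
  refine Finset.sum_eq_single s (fun t _ hts => ?_) (fun h => absurd (Finset.mem_univ s) h)
  exact Q.baseChange_form_eq_zero_of_mem_eigenspaceBaseChange_of_ne K A hsym (fun h => hts (hτ h).symm)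
    (A.eigenprojBaseChange_apply_mem K τ s x) (A.eigenprojBaseChange_apply_mem K τ t y)

/-- **General Rosati involution `σ′`: `ev_{τₛ}(φ_{Q,K}(x, y)) = Q_K(π_s x, π_t y)` for the PAIRED block `τₛ = τₜ ∘ σ′`**
(Remark 2.2's `φ₁ : V₁ × V₂ → Ω` for a CM field). [cite: Milne1999LefschetzClasses, §2 Remark 2.2 p. 647 and p. 649 L1–L8] -/
theorem Polarization.baseChangeEval_hermitianTransferBaseChange_of_pair (σ' : F ≃ₐ[ℚ] F) (hτ : Function.Injective τ)
    (hcard : Fintype.card S = Module.finrank ℚ F) (hros : ∀ a v w, Q.form (A.ι a v) w = Q.form v (A.ι (σ' a) w))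
    {s t : S} (hst : τ s = (τ t).comp (σ' : F →ₐ[ℚ] F)) (x y : K ⊗[ℚ] V) :
    baseChangeEval K (τ s) (Q.hermitianTransferBaseChange K A x y) =
      Q.form.baseChange K (A.eigenprojBaseChange K τ s x) (A.eigenprojBaseChange K τ t y) := by
  rw [Q.baseChangeEval_hermitianTransferBaseChange K A τ hτ hcard s x y]
  conv_lhs => rw [← A.sum_eigenprojBaseChange_apply K τ hτ hcard y]
  rw [map_sum]
  refine Finset.sum_eq_single t (fun u _ hut => ?_) (fun h => absurd (Finset.mem_univ t) h)
  refine Q.baseChange_form_eq_zero_of_mem_eigenspaceBaseChange K A σ' hros (fun h => hut ?_)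
    (A.eigenprojBaseChange_apply_mem K τ s x) (A.eigenprojBaseChange_apply_mem K τ u y)
  rw [hst] at h
  refine hτ (AlgHom.ext fun a => ?_)
  have := AlgHom.congr_fun h (σ'.symm a)
  simpa using this.symm

/-- **The dictionary for `S(H)(K)`: a `φ_{Q,K}`-isometry is the same as a blockwise `Q_K`-isometry** (type I; for ANY map
`γ`, block-preserving or not) — the σ-coordinates of "`φ_{Q,K}(γx, γy) = φ_{Q,K}(x, y)`" are "`Q_K(π_σ γ x, π_σ γ y) = Q_K(π_σ x, π_σ y)`";
so g20-#1's `S(H)(K) = Aut_{K⊗F}(K ⊗ V, φ_{Q,K})` and g20-#2's `S(H)(K) = ∏_σ Sp(V_{K,σ}, Q_K|)` say the same thing.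
[cite: Milne1999LefschetzClasses, §2 p. 648 L56–L63 and p. 649 L1–L29] -/
theorem Polarization.forall_hermitianTransferBaseChange_eq_iff_forall_blocks (hτ : Function.Injective τ)
    (hcard : Fintype.card S = Module.finrank ℚ F) (hsym : ∀ a v w, Q.form (A.ι a v) w = Q.form v (A.ι a w))
    (γ : K ⊗[ℚ] V → K ⊗[ℚ] V) :
    (∀ x y, Q.hermitianTransferBaseChange K A (γ x) (γ y) = Q.hermitianTransferBaseChange K A x y) ↔
      ∀ s x y, Q.form.baseChange K (A.eigenprojBaseChange K τ s (γ x)) (A.eigenprojBaseChange K τ s (γ y)) =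
        Q.form.baseChange K (A.eigenprojBaseChange K τ s x) (A.eigenprojBaseChange K τ s y) := by
  constructor
  · intro h s x y
    rw [← Q.baseChangeEval_hermitianTransferBaseChange_of_forall_form_ι K A τ hτ hcard hsym,
      ← Q.baseChangeEval_hermitianTransferBaseChange_of_forall_form_ι K A τ hτ hcard hsym, h]
  · intro h x y
    refine eq_of_forall_baseChangeEval_eq K τ (traceForm_nondegenerate ℚ F) hτ hcard fun s => ?_
    rw [Q.baseChangeEval_hermitianTransferBaseChange_of_forall_form_ι K A τ hτ hcard hsym,
      Q.baseChangeEval_hermitianTransferBaseChange_of_forall_form_ι K A τ hτ hcard hsym, h]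

end HodgeStructure

end Literature.AlgebraicGeometry.Motives
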